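/-
Literature/AlgebraicGeometry/Pohlmann1968/DegenerateCMTypesAbelianCMFieldExponentFourOdd.lean — pub-hodgecm2 (COR-CM), KEPT Literature lane
lit-deligne-3 gen 66, file F66h.  THEOREMS ONLY (no `def`, no named fact, no `sorry`, no instance, no notation; D-0026 net debt 0).  HC_CM is NOT proved.
-/
import Literature.AlgebraicGeometry.Pohlmann1968.DegenerateCMTypesAbelianCMFieldExponentTwiceOdd
import Literature.NumberTheory.ComplexMultiplication.DegenerateCMTypesAbelianKernelsExponentFourOdd
import HarnessLib

/-!
# ABELIAN CM fields with `g^{4m} = 1` on `Gal(K/ℚ)`, `m` ODD ARBITRARY: the rank of every CM type ON THE LATTICE OF SUBFIELDS,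
# `Rank(Φ) + b + 2·e₄ + Σ_{d ∣ m, d ≠ 1} (φ(2d)·s_{2,d} + φ(4d)·s_{4,d}) = [K:ℚ]/2 + 1`; the nondegeneracy criterion; the Hodge conjecture for all
# powers off the lists; `ℚ(ζ₁₀₉)`, `ℚ(ζ₁₈₁)`, `ℚ(ζ₄₀₅)`

Topic `Literature/AlgebraicGeometry/Pohlmann1968` (namespace `Literature.AlgebraicGeometry.Pohlmann1968.ExponentFourOdd`); cell `pub-hodgecm2` (COR-CM), KEPT
Literature lane `lit-deligne-3` gen 66, file F66h — the FIELD-LEVEL synthesis of the lane's ARBITRARY-ODD-PART programme at `2`-exponent `4`: the group-level F66g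
(`CyclicCMType.AbelianKernels.typeRank_add_card_kernels_eq_of_exponent_four_mul_odd`) transferred to abelian CM fields and read on the lattice of subfields by the
lane's dictionaries (index `2`: Weil quadratic; index `4`: Yanai's cyclic quartic; index `2d`, `4d`: F66a `card_index_isCyclic_eq_ncard_mixed`).  It SUBSUMES the
lane's exponent files `4p` (F64b-2), `4p²`, `4pq` (F65c), `4m` squarefree (F65j ∕ F66a §3); the exponent-`2m` sibling is F66f.  KERNEL ONLY: theorems; no `def`, no
named fact, no instance, no notation (D-0014 ∕ D-0026 net debt `0`).  HC_CM is NOT proved here or anywhere in the lane.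

## Mathematics

`K` abelian CM with `g^{4m} = 1` on `G = Gal(K/ℚ)` (`m` odd), `Φ` a CM type, `S = {g : φ₀ ∘ g⁻¹ ∈ Φ}`, `ρ` = complex conjugation.  By F66g, Kubota's defect
[Kubota1965, §4 Lemma 2] regrouped by kernels (White) is `#B₂ + 2·#B₄ + Σ_{d ∣ m, d ≠ 1} (φ(2d)·#B_{2,d} + φ(4d)·#B_{4,d})` with `B₂` (index `2`, Weil type over
the imaginary quadratic `K^H`, [Dodson1984] §3.1.1), `B₄` (index `4`, cyclic quotient, every coset met in `|H|/2` elements — [Yanai2015IndexDegeneracy]; read on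
`K^H`: a CM subfield `F` with `Gal(F/ℚ) ≅ ℤ/4` every embedding of which has `[K:F]/2` extensions in `Φ`), `B_{2,d}` ∕ `B_{4,d}` (index `2d` ∕ `4d`, cyclic
quotient, vanishing mixed differences of the coset counts along the prime torsion — the lane's F66c ∕ F66d: [Hazama2003CyclicCM] Lemma 4.6.1 mechanism,
[LamLeung2000] Thm. 2.2, [Washington1997] Prop. 2.4; read on `F = K^H`: for every family `σ_q ∈ Gal(F/ℚ)` (`q ∣ d` prime), `σ_q^q = 1`, and every
`τ : F → ℂ`, `Σ_ε (−1)^{|ε|} #{φ ∈ Φ : φ|_F = τ ∘ Π_{ε_q=1} σ_q} = 0`).  Hence (**`cmTypeRank_add_ncard_subfields_eq`**)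

  `Rank(Φ) + b(Φ) + 2·e₄(Φ) + Σ_{d ∣ m, d ≠ 1} (φ(2d)·s_{2,d}(Φ) + φ(4d)·s_{4,d}(Φ)) = [K:ℚ]/2 + 1`,

NONDEGENERATE iff all four families of subfield sets are empty (**`isNondegenerate_iff_forall_intermediateField`**), and then `B•(Aⁿ) ⊗ ℂ = D•(Aⁿ) ⊗ ℂ` and the
Hodge conjecture for all powers of every abelian variety of type `(K; Φ)` (Pohlmann ∕ Hazama; tree `IsNondegenerate.hodgeClassSpan_pow_eq_divisorClassesSpan`).

* §1 on `Gal(K/ℚ)`: `cmTypeRank_add_card_kernels_eq`.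
* §2 on subfields: **`cmTypeRank_add_ncard_subfields_eq`**, **`isNondegenerate_iff_forall_intermediateField`**.
* §3 abelian varieties: `hodgeClassSpan_pow_eq_divisorClassesSpan_of_forall_intermediateField`, **`hodgeConjectureFor_pow_of_forall_intermediateField`**.
* §4 cyclotomic fields `ℚ(ζ_N)` with `u^{4m} = 1` on `(ℤ/N)ˣ`, `m` odd, and the first levels of `2`-exponent `4` whose odd exponent part is neither squarefree
  nor a prime square: `ℚ(ζ₁₀₉)` (`ℤ/108`, `m = 27`), `ℚ(ζ₁₈₁)` (`ℤ/180`, `m = 45`), `ℚ(ζ₄₀₅)` (`405 = 5·3⁴`, `ℤ/4 × ℤ/54`, exponent `108`, `m = 27`).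

PRESEARCH (lane rule): as for F65j ∕ F66a ∕ F66f ∕ F66g (corpus hybrid + vector, galaxy «degenerate CM type | rank of a CM-type | index of degeneracy», all
stars, lane queries gen 64–66): the statement with divisor classes and cyclic-Galois clauses is not found as printed; the cyclic case is [Hazama2003CyclicCM]
Thm. 4.8; recorded as the lane's own elementary theorem with the citations above.

HONEST REGISTER.  Unconditional given the tree; `2`-part of the exponent `≤ 4`; nothing is claimed about the Hodge classes of DEGENERATE types; the cyclotomic
statements carry the true instance hypotheses `[IsCMField L] [IsAbelianGalois ℚ L]`.  HC_CM is NOT proved and not used.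

## References

* [Kubota1965] T. Kubota, *On the field extension by complex multiplication*, Trans. AMS 118 (1965), §4 Lemma 2.
* [White1993SporadicCycles] S. P. White, *Sporadic cycles on CM abelian varieties*, Compositio Math. 88 (1993), §4, proof of Lemma 3 (p. 131).
* [Dodson1984] B. Dodson, *The structure of Galois groups of CM-fields*, Trans. AMS 283 (1984), §3.1.1 Theorem.
* [Yanai2015IndexDegeneracy] H. Yanai, *On degenerate CM-types*, J. Number Theory 152 (2015), Thm. 4.1 (proof, p. 818).
* [Hazama2003CyclicCM] F. Hazama, *Hodge cycles on abelian varieties with complex multiplication by cyclic CM-fields*, J. Math. Sci. Univ. Tokyo 10 (2003):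
  Prop. 4.3, Lemma 4.6.1, Thm. 4.8.
* [LamLeung2000] T. Y. Lam, K. H. Leung, *On vanishing sums of roots of unity*, J. Algebra 224 (2000), Thm. 2.2.
* [Gordon1999HodgeAVSurvey] B. B. Gordon, *A survey of the Hodge conjecture for abelian varieties* (1999), Thm. 6.4, §9.3.
* [Washington1997] L. C. Washington, *Introduction to cyclotomic fields*, 2nd ed. (1997), Ch. 2: Prop. 2.4, Thm. 2.5.

## Provenance

Cell `pub-hodgecm2` (COR-CM), KEPT Literature lane `lit-deligne-3` gen 66 (claim ABELIAN-EXPONENT-4ODD-FIELD; count-neutral, own lane), file F66h; neighbours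
cited by name, nothing restated: `DegenerateCMTypesAbelianKernelsExponentFourOdd` (F66g), `DegenerateCMTypesAbelianCMFieldExponentTwiceOdd` (F66f, cone),
`DegenerateCMTypesAbelianCMFieldMixedDifferencesSubfields` (F66a: `card_index_isCyclic_eq_ncard_mixed`, `forall_subgroup_isCyclic_iff_forall_intermediateField_mixed`),
`DegenerateCMTypesAbelianCMFieldCyclicSubfields` (`card_indexTwo_eq_ncard_weilQuadratic`, `card_indexFour_eq_ncard_weilQuartic`, `card_filter_mem_eq_iff_balanced`,
`forall_two_mul_card_filter_eq_iff_forall_fibre`), `ExponentFourTimesPrime.cm_abelian_pow_eq_one_of_isCyclotomicExtension`.  Theorems only; net Literature debt 0.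
-/

noncomputable section

open scoped BigOperators NumberField IsMulCommutative Classical
open NumberField IntermediateField

namespace Literature.AlgebraicGeometry.Pohlmann1968

namespace ExponentFourOdd

open Literature.NumberTheory.ComplexMultiplication
open Literature.NumberTheory.ComplexMultiplication.CMNumbers
open Literature.AlgebraicGeometry.Motives (CMType)
open Literature.AlgebraicGeometry.Pohlmann1968.CyclicTwoOddPrimes (isCMTypeWith_galType cmTypeRank_eq_typeRank_galType)
open Literature.AlgebraicGeometry.Pohlmann1968.AbelianKernels
open Literature.AlgebraicGeometry.Pohlmann1968.MixedDifferencesReading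
open Literature.AlgebraicGeometry.Pohlmann1968.ExponentFourTimesPrime (cm_abelian_pow_eq_one_of_isCyclotomicExtension)

/-! ## §1 On `Gal(K/ℚ)`: the defect by divisor classes -/

section Field

variable {K : Type} [Field K] [NumberField K] [IsCMField K] [IsAbelianGalois ℚ K] {m : ℕ}

/-- **The defect on `Gal(K/ℚ)` for an abelian CM field with `g^{4m} = 1`, `m` odd**: `Rank(Φ) + #B₂ + 2·#B₄ + Σ_{d ∣ m, d ≠ 1} (φ(2d)·#B_{2,d} + φ(4d)·#B_{4,d})
= [K:ℚ]/2 + 1` — the lane's group-level F66g read on `Gal(K/ℚ)` (`S = {g : φ₀ ∘ g⁻¹ ∈ Φ}`). [cite: Kubota1965, §4 Lemma 2] [cite: Hazama2003CyclicCM, Prop. 4.3 and Thm. 4.8]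
[cite: Dodson1984, §3.1.1 Theorem] [cite: Yanai2015IndexDegeneracy, Thm. 4.1] [cite: LamLeung2000, Thm. 2.2] -/
theorem cmTypeRank_add_card_kernels_eq (hodd : ¬ 2 ∣ m) (φ₀ : K →+* ℂ) (hexp : ∀ g : K ≃ₐ[ℚ] K, g ^ (4 * m) = 1) (Φ : CMType K) :
    cmTypeRank Φ +
      ((Finset.univ : Finset (Subgroup (K ≃ₐ[ℚ] K))).filter fun H =>
        (conjGal : K ≃ₐ[ℚ] K) ∉ H ∧ H.index = 2 ∧
        ((Finset.univ.filter fun g : K ≃ₐ[ℚ] K => embOf φ₀ g ∈ Φ.1).filter fun s => s ∈ H).card =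
          ((Finset.univ.filter fun g : K ≃ₐ[ℚ] K => embOf φ₀ g ∈ Φ.1).filter fun s => s ∉ H).card).card +
      2 * ((Finset.univ : Finset (Subgroup (K ≃ₐ[ℚ] K))).filter fun H : Subgroup (K ≃ₐ[ℚ] K) =>
        (conjGal : K ≃ₐ[ℚ] K) ∉ H ∧ H.index = 4 ∧ IsCyclic ((K ≃ₐ[ℚ] K) ⧸ H) ∧
        ∀ g : K ≃ₐ[ℚ] K, 2 * (((Finset.univ.filter fun g : K ≃ₐ[ℚ] K => embOf φ₀ g ∈ Φ.1).filter fun s => g⁻¹ * s ∈ H).card) =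
          Nat.card H).card +
      ∑ d ∈ m.divisors.erase 1,
        ((2 * d).totient *
          ((Finset.univ : Finset (Subgroup (K ≃ₐ[ℚ] K))).filter fun H => (conjGal : K ≃ₐ[ℚ] K) ∉ H ∧ H.index = 2 * d ∧
            IsCyclic ((K ≃ₐ[ℚ] K) ⧸ H) ∧
            ∀ (g : K ≃ₐ[ℚ] K) (x : ↥d.primeFactors → (K ≃ₐ[ℚ] K)), (∀ q, x q ^ (q : ℕ) ∈ H) →
              ∑ ε : ↥d.primeFactors → Bool, (∏ q, (if ε q then (-1 : ℤ) else 1)) *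
                (((Finset.univ.filter fun g : K ≃ₐ[ℚ] K => embOf φ₀ g ∈ Φ.1).filter
                  fun s => (g * ∏ q, (if ε q then x q else 1))⁻¹ * s ∈ H).card : ℤ) = 0).card +
        (4 * d).totient *
          ((Finset.univ : Finset (Subgroup (K ≃ₐ[ℚ] K))).filter fun H => (conjGal : K ≃ₐ[ℚ] K) ∉ H ∧ H.index = 4 * d ∧
            IsCyclic ((K ≃ₐ[ℚ] K) ⧸ H) ∧
            ∀ (g : K ≃ₐ[ℚ] K) (x : ↥d.primeFactors → (K ≃ₐ[ℚ] K)), (∀ q, x q ^ (q : ℕ) ∈ H) →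
              ∑ ε : ↥d.primeFactors → Bool, (∏ q, (if ε q then (-1 : ℤ) else 1)) *
                (((Finset.univ.filter fun g : K ≃ₐ[ℚ] K => embOf φ₀ g ∈ Φ.1).filter
                  fun s => (g * ∏ q, (if ε q then x q else 1))⁻¹ * s ∈ H).card : ℤ) = 0).card) =
      Module.finrank ℚ K / 2 + 1 := by
  rw [cmTypeRank_eq_typeRank_galType Φ φ₀, ← card_gal_eq_finrank φ₀]
  exact CyclicCMType.AbelianKernels.typeRank_add_card_kernels_eq_of_exponent_four_mul_odd hodd
    (isCMTypeWith_galType (AbelianCMFieldExistence.apply_conjGal_eq φ₀) Φ) hexp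

end Field

/-! ## §2 On the lattice of subfields: the intrinsic rank formula and the nondegeneracy criterion -/

section Subfields

variable {K : Type} [Field K] [NumberField K] [IsCMField K] [IsAbelianGalois ℚ K] {m : ℕ}

/-- **THE RANK OF A CM TYPE OF AN ABELIAN CM FIELD WITH `g^{4m} = 1` ON `Gal(K/ℚ)`, `m` ODD, ON THE LATTICE OF SUBFIELDS.**  For ANY CM type `Φ` of `K`,

  `Rank(Φ) + b(Φ) + 2·e₄(Φ) + Σ_{d ∣ m, d ≠ 1} (φ(2d)·s_{2,d}(Φ) + φ(4d)·s_{4,d}(Φ)) = [K:ℚ]/2 + 1`,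

`b` = the imaginary quadratic subfields over which `Φ` is of Weil type; `e₄` = the CM subfields `F` with `Gal(F/ℚ) ≅ ℤ/4` every embedding of which has `[K:F]/2`
extensions in `Φ` (Yanai); `s_{2,d}` (resp. `s_{4,d}`) = the CM subfields `F` of degree `2d` (resp. `4d`) WITH `Gal(F/ℚ)` CYCLIC over which `Φ` has vanishing
mixed differences along the prime torsion: for every family `σ_q ∈ Gal(F/ℚ)` (`q ∣ d` prime), `σ_q^q = 1`, and every `τ : F → ℂ`,
`Σ_{ε ∈ {0,1}^{primes(d)}} (−1)^{|ε|} #{φ ∈ Φ : φ|_F = τ ∘ Π_{ε_q = 1} σ_q} = 0`. [cite: Kubota1965, §4 Lemma 2] [cite: Hazama2003CyclicCM, Prop. 4.3 and Thm. 4.8]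
[cite: Dodson1984, §3.1.1 Theorem] [cite: Yanai2015IndexDegeneracy, Thm. 4.1 (proof, p. 818)] [cite: LamLeung2000, Thm. 2.2] [cite: Gordon1999HodgeAVSurvey, 9.4.3] -/
theorem cmTypeRank_add_ncard_subfields_eq (hodd : ¬ 2 ∣ m) (hexp : ∀ g : K ≃ₐ[ℚ] K, g ^ (4 * m) = 1) (Φ : CMType K) :
    cmTypeRank Φ + {F : IntermediateField ℚ K | Module.finrank ℚ F = 2 ∧ ¬ IsTotallyReal F ∧
        ∀ τ : F →+* ℂ, {φ : K →+* ℂ | φ.comp (algebraMap F K) = τ ∧ φ ∈ Φ.1}.ncard =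
          {φ : K →+* ℂ | φ.comp (algebraMap F K) = τ ∧ φ ∉ Φ.1}.ncard}.ncard +
      2 * {F : IntermediateField ℚ K | Module.finrank ℚ F = 4 ∧ ¬ IsTotallyReal F ∧ IsCyclic (F ≃ₐ[ℚ] F) ∧
        ∀ τ : F →+* ℂ, 2 * {φ : K →+* ℂ | φ.comp (algebraMap F K) = τ ∧ φ ∈ Φ.1}.ncard = Module.finrank F K}.ncard +
      ∑ d ∈ m.divisors.erase 1,
        ((2 * d).totient *
          {F : IntermediateField ℚ K | Module.finrank ℚ F = 2 * d ∧ ¬ IsTotallyReal F ∧ IsCyclic (F ≃ₐ[ℚ] F) ∧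
            ∀ [IsAbelianGalois ℚ F] (σ : ↥d.primeFactors → (F ≃ₐ[ℚ] F)), (∀ q, σ q ^ (q : ℕ) = 1) → ∀ τ : F →+* ℂ,
              ∑ ε : ↥d.primeFactors → Bool, (∏ q, (if ε q then (-1 : ℤ) else 1)) *
                ({φ : K →+* ℂ | φ.comp (algebraMap F K) = τ.comp (∏ q, (if ε q then σ q else 1)).toRingEquiv.toRingHom ∧
                  φ ∈ Φ.1}.ncard : ℤ) = 0}.ncard +
        (4 * d).totient *
          {F : IntermediateField ℚ K | Module.finrank ℚ F = 4 * d ∧ ¬ IsTotallyReal F ∧ IsCyclic (F ≃ₐ[ℚ] F) ∧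
            ∀ [IsAbelianGalois ℚ F] (σ : ↥d.primeFactors → (F ≃ₐ[ℚ] F)), (∀ q, σ q ^ (q : ℕ) = 1) → ∀ τ : F →+* ℂ,
              ∑ ε : ↥d.primeFactors → Bool, (∏ q, (if ε q then (-1 : ℤ) else 1)) *
                ({φ : K →+* ℂ | φ.comp (algebraMap F K) = τ.comp (∏ q, (if ε q then σ q else 1)).toRingEquiv.toRingHom ∧
                  φ ∈ Φ.1}.ncard : ℤ) = 0}.ncard) = Module.finrank ℚ K / 2 + 1 := by
  obtain ⟨φ₀⟩ := (inferInstance : Nonempty (K →+* ℂ))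
  rw [← card_indexTwo_eq_ncard_weilQuadratic φ₀ Φ, ← card_indexFour_eq_ncard_weilQuartic φ₀ Φ, ← cmTypeRank_add_card_kernels_eq hodd φ₀ hexp Φ]
  congr 1
  refine Finset.sum_congr rfl fun d _ => ?_
  rw [card_index_isCyclic_eq_ncard_mixed φ₀ Φ (fun q : ↥d.primeFactors => (q : ℕ)) (2 * d),
    card_index_isCyclic_eq_ncard_mixed φ₀ Φ (fun q : ↥d.primeFactors => (q : ℕ)) (4 * d)]

/-- **NONDEGENERACY CRITERION ON THE LATTICE OF SUBFIELDS (`g^{4m} = 1` on `Gal(K/ℚ)`, `m` odd).**  `Φ` is NONDEGENERATE iff (i) it is of Weil type over NO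
imaginary quadratic subfield, (ii) «half of every fibre» holds over NO CM subfield with `Gal ≅ ℤ/4` (Yanai), and for every divisor `d ≠ 1` of `m` the mixed
differences of the multiplicities of `Φ|_F` along the prime torsion vanish (iii) over NO CM subfield `F` of degree `2d` with cyclic `Gal(F/ℚ)` and (iv) over
NO CM subfield `F` of degree `4d` with cyclic `Gal(F/ℚ)`. [cite: Kubota1965, §4 Lemma 2] [cite: Hazama2003CyclicCM, Prop. 4.3 and Thm. 4.8]
[cite: Dodson1984, §3.1.1 Theorem] [cite: Yanai2015IndexDegeneracy, Thm. 4.1] -/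
theorem isNondegenerate_iff_forall_intermediateField (hodd : ¬ 2 ∣ m) (hexp : ∀ g : K ≃ₐ[ℚ] K, g ^ (4 * m) = 1) (Φ : CMType K) :
    IsNondegenerate Φ ↔
      (∀ F : IntermediateField ℚ K, Module.finrank ℚ F = 2 → ¬ IsTotallyReal F →
        ¬ ∀ τ : F →+* ℂ, {φ : K →+* ℂ | φ.comp (algebraMap F K) = τ ∧ φ ∈ Φ.1}.ncard =
          {φ : K →+* ℂ | φ.comp (algebraMap F K) = τ ∧ φ ∉ Φ.1}.ncard) ∧
      (∀ F : IntermediateField ℚ K, Module.finrank ℚ F = 4 → ¬ IsTotallyReal F → IsCyclic (F ≃ₐ[ℚ] F) →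
        ¬ ∀ τ : F →+* ℂ, 2 * {φ : K →+* ℂ | φ.comp (algebraMap F K) = τ ∧ φ ∈ Φ.1}.ncard = Module.finrank F K) ∧
      (∀ d : ℕ, d ∣ m → d ≠ 1 → ∀ F : IntermediateField ℚ K, Module.finrank ℚ F = 2 * d → ¬ IsTotallyReal F → IsCyclic (F ≃ₐ[ℚ] F) →
        ∀ [IsAbelianGalois ℚ F],
        ¬ ∀ σ : ↥d.primeFactors → (F ≃ₐ[ℚ] F), (∀ q, σ q ^ (q : ℕ) = 1) → ∀ τ : F →+* ℂ,
          ∑ ε : ↥d.primeFactors → Bool, (∏ q, (if ε q then (-1 : ℤ) else 1)) *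
            ({φ : K →+* ℂ | φ.comp (algebraMap F K) = τ.comp (∏ q, (if ε q then σ q else 1)).toRingEquiv.toRingHom ∧
              φ ∈ Φ.1}.ncard : ℤ) = 0) ∧
      (∀ d : ℕ, d ∣ m → d ≠ 1 → ∀ F : IntermediateField ℚ K, Module.finrank ℚ F = 4 * d → ¬ IsTotallyReal F → IsCyclic (F ≃ₐ[ℚ] F) →
        ∀ [IsAbelianGalois ℚ F],
        ¬ ∀ σ : ↥d.primeFactors → (F ≃ₐ[ℚ] F), (∀ q, σ q ^ (q : ℕ) = 1) → ∀ τ : F →+* ℂ,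
          ∑ ε : ↥d.primeFactors → Bool, (∏ q, (if ε q then (-1 : ℤ) else 1)) *
            ({φ : K →+* ℂ | φ.comp (algebraMap F K) = τ.comp (∏ q, (if ε q then σ q else 1)).toRingEquiv.toRingHom ∧
              φ ∈ Φ.1}.ncard : ℤ) = 0) := by
  obtain ⟨φ₀⟩ := (inferInstance : Nonempty (K →+* ℂ))
  rw [Pohlmann1968.isNondegenerate_iff Φ, cmTypeRank_eq_typeRank_galType Φ φ₀, ← card_gal_eq_finrank φ₀,
    CyclicCMType.AbelianKernels.typeRank_eq_iff_of_exponent_four_mul_odd hodd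
      (isCMTypeWith_galType (AbelianCMFieldExistence.apply_conjGal_eq φ₀) Φ) hexp]
  refine and_congr ?_ (and_congr ?_ (and_congr ?_ ?_))
  · constructor
    · intro h F h2 hF hW
      have hρH : (conjGal : K ≃ₐ[ℚ] K) ∉ F.fixingSubgroup := (conjGal_not_mem_fixingSubgroup_iff F).2 hF
      exact h F.fixingSubgroup hρH (index_fixingSubgroup_eq_two F h2) ((card_filter_mem_eq_iff_balanced φ₀ Φ F h2 hF).2 hW)
    · intro h H hρH hidx hsplit
      have h2 : Module.finrank ℚ (fixedField H) = 2 := by rw [← index_eq_finrank_fixedField, hidx]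
      have hF : ¬ IsTotallyReal (fixedField H) := (conjGal_not_mem_iff_not_isTotallyReal_fixedField H).1 hρH
      refine h (fixedField H) h2 hF ((card_filter_mem_eq_iff_balanced φ₀ Φ (fixedField H) h2 hF).1 ?_)
      simpa only [fixingSubgroup_fixedField] using hsplit
  · constructor
    · intro h F h4 hF hcyc hQ
      exact h F.fixingSubgroup ((conjGal_not_mem_fixingSubgroup_iff F).2 hF)
        (by rw [CMNumbers.index_fixingSubgroup_eq_finrank, h4]) ((isCyclic_quotient_fixingSubgroup_iff F).2 hcyc)
        ((forall_two_mul_card_filter_eq_iff_forall_fibre φ₀ Φ F).2 hQ)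
    · intro h H hρH hidx hcyc hQ
      refine h (fixedField H) (by rw [← index_eq_finrank_fixedField, hidx])
        ((conjGal_not_mem_iff_not_isTotallyReal_fixedField H).1 hρH) ((isCyclic_quotient_iff_isCyclic_gal_fixedField H).1 hcyc)
        ((forall_two_mul_card_filter_eq_iff_forall_fibre φ₀ Φ (fixedField H)).1 ?_)
      simpa only [fixingSubgroup_fixedField] using hQ
  · refine forall_congr' fun d => forall_congr' fun _ => forall_congr' fun _ => ?_
    exact forall_subgroup_isCyclic_iff_forall_intermediateField_mixed φ₀ Φ (fun q : ↥d.primeFactors => (q : ℕ)) (2 * d)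
  · refine forall_congr' fun d => forall_congr' fun _ => forall_congr' fun _ => ?_
    exact forall_subgroup_isCyclic_iff_forall_intermediateField_mixed φ₀ Φ (fun q : ↥d.primeFactors => (q : ℕ)) (4 * d)

end Subfields

/-! ## §3 Consequences for abelian varieties: `B•(Aⁿ) ⊗ ℂ = D•(Aⁿ) ⊗ ℂ` and the Hodge conjecture for all powers off the subfield lists -/

section Varieties

open Literature.AlgebraicGeometry.Motives (AbelianVariety)
open Literature.AlgebraicGeometry.HodgeTheory
open Literature.AlgebraicGeometry.ComplexMultiplication (IsCMTypeRealisation)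
open Literature.AlgebraicGeometry.VanGeemen1994 (hodgeClassSpan)
open Literature.Barriers.HodgeConjecture (divisorClassesSpan)
open _root_.CategoryTheory _root_.CategoryTheory.Limits

variable {K : Type} [Field K] [NumberField K] [IsCMField K] [IsAbelianGalois ℚ K] {m : ℕ}
  {Φ : CMType K} {A : AbelianVariety ℂ} {ι : 𝓞 K →+* End A} {θ : K →+* Module.End ℂ (complexBetti A.X 1)}

/-- `Bᵐ ⊗ ℂ = Dᵐ ⊗ ℂ` for all `m` on an abelian variety gives the Hodge conjecture for it (Lefschetz `(1,1)`, cup products, tree theorems).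
[cite: Gordon1999HodgeAVSurvey, §9.3] -/
private theorem hodgeConjectureFor_of_forall_hodgeClassSpan_eq_fo (B : AbelianVariety ℂ)
    (h : ∀ n : ℕ, hodgeClassSpan B.dim B.X n = divisorClassesSpan B.X B.dim n) : HodgeConjectureFor B.dim B.X :=
  ⟨nonempty_hodgeModel_holds (Motives.AbelianVariety.isSmoothProjective_holds (A := B)),
    fun n _ hc hmm ↦ AbelianVariety.divisorClassesSpan_le_algebraicClasses B
      (fun b hb hb' ↦ lefschetzOneOne_rational_holds (Motives.AbelianVariety.isSmoothProjective_holds (A := B)) b hb hb') n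
      ((h n) ▸ Submodule.subset_span ⟨hc, hmm⟩)⟩

/-- **`B•(Aⁿ) ⊗ ℂ = D•(Aⁿ) ⊗ ℂ` FOR EVERY REALISATION OF A TYPE OFF THE FOUR SUBFIELD LISTS (`g^{4m} = 1` on `Gal`, `m` odd)** (Weil type over no imaginary
quadratic subfield; «half of every fibre» over no cyclic quartic CM subfield; for every divisor `d ≠ 1` of `m`, non-vanishing mixed differences along the prime
torsion over every CM subfield of degree `2d`, and of degree `4d`, with cyclic Galois group). [cite: Kubota1965, §4 Lemma 2] [cite: Gordon1999HodgeAVSurvey, Thm. 6.4 and §9.3]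
[cite: Hazama2003CyclicCM, Prop. 4.3 and Thm. 4.8] [cite: Yanai2015IndexDegeneracy, Thm. 4.1] -/
theorem hodgeClassSpan_pow_eq_divisorClassesSpan_of_forall_intermediateField (hodd : ¬ 2 ∣ m) (hexp : ∀ g : K ≃ₐ[ℚ] K, g ^ (4 * m) = 1)
    (hW : ∀ F : IntermediateField ℚ K, Module.finrank ℚ F = 2 → ¬ IsTotallyReal F →
        ¬ ∀ τ : F →+* ℂ, {φ : K →+* ℂ | φ.comp (algebraMap F K) = τ ∧ φ ∈ Φ.1}.ncard =
          {φ : K →+* ℂ | φ.comp (algebraMap F K) = τ ∧ φ ∉ Φ.1}.ncard)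
    (hQ : ∀ F : IntermediateField ℚ K, Module.finrank ℚ F = 4 → ¬ IsTotallyReal F → IsCyclic (F ≃ₐ[ℚ] F) →
        ¬ ∀ τ : F →+* ℂ, 2 * {φ : K →+* ℂ | φ.comp (algebraMap F K) = τ ∧ φ ∈ Φ.1}.ncard = Module.finrank F K)
    (hD : ∀ d : ℕ, d ∣ m → d ≠ 1 → ∀ F : IntermediateField ℚ K, Module.finrank ℚ F = 2 * d → ¬ IsTotallyReal F → IsCyclic (F ≃ₐ[ℚ] F) →
        ∀ [IsAbelianGalois ℚ F],
        ¬ ∀ σ : ↥d.primeFactors → (F ≃ₐ[ℚ] F), (∀ q, σ q ^ (q : ℕ) = 1) → ∀ τ : F →+* ℂ,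
          ∑ ε : ↥d.primeFactors → Bool, (∏ q, (if ε q then (-1 : ℤ) else 1)) *
            ({φ : K →+* ℂ | φ.comp (algebraMap F K) = τ.comp (∏ q, (if ε q then σ q else 1)).toRingEquiv.toRingHom ∧
              φ ∈ Φ.1}.ncard : ℤ) = 0)
    (hD4 : ∀ d : ℕ, d ∣ m → d ≠ 1 → ∀ F : IntermediateField ℚ K, Module.finrank ℚ F = 4 * d → ¬ IsTotallyReal F → IsCyclic (F ≃ₐ[ℚ] F) →
        ∀ [IsAbelianGalois ℚ F],
        ¬ ∀ σ : ↥d.primeFactors → (F ≃ₐ[ℚ] F), (∀ q, σ q ^ (q : ℕ) = 1) → ∀ τ : F →+* ℂ,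
          ∑ ε : ↥d.primeFactors → Bool, (∏ q, (if ε q then (-1 : ℤ) else 1)) *
            ({φ : K →+* ℂ | φ.comp (algebraMap F K) = τ.comp (∏ q, (if ε q then σ q else 1)).toRingEquiv.toRingHom ∧
              φ ∈ Φ.1}.ncard : ℤ) = 0)
    (hA : IsCMTypeRealisation Φ A ι θ) (n k : ℕ) :
    hodgeClassSpan (⨁ fun _ : Fin n => A).dim (⨁ fun _ : Fin n => A).X k =
      divisorClassesSpan (⨁ fun _ : Fin n => A).X (⨁ fun _ : Fin n => A).dim k :=
  ((isNondegenerate_iff_forall_intermediateField hodd hexp Φ).2 ⟨hW, hQ, hD, hD4⟩).hodgeClassSpan_pow_eq_divisorClassesSpan hA n k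

/-- **THE HODGE CONJECTURE FOR ALL POWERS OF EVERY REALISATION OF A TYPE OFF THE FOUR SUBFIELD LISTS (`g^{4m} = 1` on `Gal`, `m` odd)** — UNCONDITIONAL, any
realisation, hypotheses on the lattice of subfields only. [cite: Gordon1999HodgeAVSurvey, Thm. 6.4 and §9.3] [cite: Kubota1965, §4 Lemma 2] [cite: Deligne2000, §1] -/
theorem hodgeConjectureFor_pow_of_forall_intermediateField (hodd : ¬ 2 ∣ m) (hexp : ∀ g : K ≃ₐ[ℚ] K, g ^ (4 * m) = 1)
    (hW : ∀ F : IntermediateField ℚ K, Module.finrank ℚ F = 2 → ¬ IsTotallyReal F →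
        ¬ ∀ τ : F →+* ℂ, {φ : K →+* ℂ | φ.comp (algebraMap F K) = τ ∧ φ ∈ Φ.1}.ncard =
          {φ : K →+* ℂ | φ.comp (algebraMap F K) = τ ∧ φ ∉ Φ.1}.ncard)
    (hQ : ∀ F : IntermediateField ℚ K, Module.finrank ℚ F = 4 → ¬ IsTotallyReal F → IsCyclic (F ≃ₐ[ℚ] F) →
        ¬ ∀ τ : F →+* ℂ, 2 * {φ : K →+* ℂ | φ.comp (algebraMap F K) = τ ∧ φ ∈ Φ.1}.ncard = Module.finrank F K)
    (hD : ∀ d : ℕ, d ∣ m → d ≠ 1 → ∀ F : IntermediateField ℚ K, Module.finrank ℚ F = 2 * d → ¬ IsTotallyReal F → IsCyclic (F ≃ₐ[ℚ] F) →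
        ∀ [IsAbelianGalois ℚ F],
        ¬ ∀ σ : ↥d.primeFactors → (F ≃ₐ[ℚ] F), (∀ q, σ q ^ (q : ℕ) = 1) → ∀ τ : F →+* ℂ,
          ∑ ε : ↥d.primeFactors → Bool, (∏ q, (if ε q then (-1 : ℤ) else 1)) *
            ({φ : K →+* ℂ | φ.comp (algebraMap F K) = τ.comp (∏ q, (if ε q then σ q else 1)).toRingEquiv.toRingHom ∧
              φ ∈ Φ.1}.ncard : ℤ) = 0)
    (hD4 : ∀ d : ℕ, d ∣ m → d ≠ 1 → ∀ F : IntermediateField ℚ K, Module.finrank ℚ F = 4 * d → ¬ IsTotallyReal F → IsCyclic (F ≃ₐ[ℚ] F) →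
        ∀ [IsAbelianGalois ℚ F],
        ¬ ∀ σ : ↥d.primeFactors → (F ≃ₐ[ℚ] F), (∀ q, σ q ^ (q : ℕ) = 1) → ∀ τ : F →+* ℂ,
          ∑ ε : ↥d.primeFactors → Bool, (∏ q, (if ε q then (-1 : ℤ) else 1)) *
            ({φ : K →+* ℂ | φ.comp (algebraMap F K) = τ.comp (∏ q, (if ε q then σ q else 1)).toRingEquiv.toRingHom ∧
              φ ∈ Φ.1}.ncard : ℤ) = 0)
    (hA : IsCMTypeRealisation Φ A ι θ) (n : ℕ) :
    HodgeConjectureFor (⨁ fun _ : Fin n => A).dim (⨁ fun _ : Fin n => A).X :=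
  hodgeConjectureFor_of_forall_hodgeClassSpan_eq_fo _
    fun k ↦ hodgeClassSpan_pow_eq_divisorClassesSpan_of_forall_intermediateField hodd hexp hW hQ hD hD4 hA n k

end Varieties

/-! ## §4 The cyclotomic fields `ℚ(ζ_N)` with `u^{4m} = 1` on `(ℤ/N)ˣ`, `m` odd; the levels `109, 181, 405` -/

section Cyclotomic

open Literature.AlgebraicGeometry.Motives (AbelianVariety)
open Literature.AlgebraicGeometry.HodgeTheory
open Literature.AlgebraicGeometry.ComplexMultiplication (IsCMTypeRealisation)
open _root_.CategoryTheory _root_.CategoryTheory.Limits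

variable {N m : ℕ} {L : Type} [Field L] [NumberField L]
  {Φ : CMType L} {A : AbelianVariety ℂ} {ι : 𝓞 L →+* End A} {θ : L →+* Module.End ℂ (complexBetti A.X 1)}

/-- **The Hodge conjecture for all powers of every abelian variety with CM by `ℚ(ζ_N)`, `(ℤ/N)ˣ` of exponent dividing `4m` (`m` odd), whose type is off the four
subfield lists.**  Instance hypotheses `[IsCMField L] [IsAbelianGalois ℚ L]` as in the neighbours (true for `ℚ(ζ_N)`, `N > 2`, tree
`cm_abelian_pow_eq_one_of_isCyclotomicExtension`). [cite: Gordon1999HodgeAVSurvey, Thm. 6.4 and §9.3] [cite: Washington1997, Ch. 2 Thm. 2.5] -/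
theorem hodgeConjectureFor_pow_of_forall_intermediateField_of_isCyclotomicExtension [NeZero N] [IsCyclotomicExtension {N} ℚ L]
    [IsCMField L] [IsAbelianGalois ℚ L] (h2N : 2 < N) (hodd : ¬ 2 ∣ m) (hN : ∀ u : (ZMod N)ˣ, u ^ (4 * m) = 1)
    (hW : ∀ F : IntermediateField ℚ L, Module.finrank ℚ F = 2 → ¬ IsTotallyReal F →
        ¬ ∀ τ : F →+* ℂ, {φ : L →+* ℂ | φ.comp (algebraMap F L) = τ ∧ φ ∈ Φ.1}.ncard =
          {φ : L →+* ℂ | φ.comp (algebraMap F L) = τ ∧ φ ∉ Φ.1}.ncard)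
    (hQ : ∀ F : IntermediateField ℚ L, Module.finrank ℚ F = 4 → ¬ IsTotallyReal F → IsCyclic (F ≃ₐ[ℚ] F) →
        ¬ ∀ τ : F →+* ℂ, 2 * {φ : L →+* ℂ | φ.comp (algebraMap F L) = τ ∧ φ ∈ Φ.1}.ncard = Module.finrank F L)
    (hD : ∀ d : ℕ, d ∣ m → d ≠ 1 → ∀ F : IntermediateField ℚ L, Module.finrank ℚ F = 2 * d → ¬ IsTotallyReal F → IsCyclic (F ≃ₐ[ℚ] F) →
        ∀ [IsAbelianGalois ℚ F],
        ¬ ∀ σ : ↥d.primeFactors → (F ≃ₐ[ℚ] F), (∀ q, σ q ^ (q : ℕ) = 1) → ∀ τ : F →+* ℂ,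
          ∑ ε : ↥d.primeFactors → Bool, (∏ q, (if ε q then (-1 : ℤ) else 1)) *
            ({φ : L →+* ℂ | φ.comp (algebraMap F L) = τ.comp (∏ q, (if ε q then σ q else 1)).toRingEquiv.toRingHom ∧
              φ ∈ Φ.1}.ncard : ℤ) = 0)
    (hD4 : ∀ d : ℕ, d ∣ m → d ≠ 1 → ∀ F : IntermediateField ℚ L, Module.finrank ℚ F = 4 * d → ¬ IsTotallyReal F → IsCyclic (F ≃ₐ[ℚ] F) →
        ∀ [IsAbelianGalois ℚ F],
        ¬ ∀ σ : ↥d.primeFactors → (F ≃ₐ[ℚ] F), (∀ q, σ q ^ (q : ℕ) = 1) → ∀ τ : F →+* ℂ,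
          ∑ ε : ↥d.primeFactors → Bool, (∏ q, (if ε q then (-1 : ℤ) else 1)) *
            ({φ : L →+* ℂ | φ.comp (algebraMap F L) = τ.comp (∏ q, (if ε q then σ q else 1)).toRingEquiv.toRingHom ∧
              φ ∈ Φ.1}.ncard : ℤ) = 0)
    (hA : IsCMTypeRealisation Φ A ι θ) (n : ℕ) :
    HodgeConjectureFor (⨁ fun _ : Fin n => A).dim (⨁ fun _ : Fin n => A).X :=
  hodgeConjectureFor_pow_of_forall_intermediateField hodd (cm_abelian_pow_eq_one_of_isCyclotomicExtension h2N hN L).2.2.1 hW hQ hD hD4 hA n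

/-! ### The levels `109` (`ℤ/108`, `m = 27`), `181` (`ℤ/180`, `m = 45`), `405` (`ℤ/4 × ℤ/54`, exponent `108`, `m = 27`): the first cyclotomic fields of
`2`-exponent `4` whose odd exponent part is neither squarefree nor the square of a prime -/

/-- `u¹⁰⁸ = 1` for every unit of `ℤ/109` (`109` prime; kernel decision on residues). [cite: Washington1997, Ch. 2 Thm. 2.5] -/
theorem units_pow_oneHundredEight_oneHundredNine (u : (ZMod 109)ˣ) : u ^ (4 * 27) = 1 := by
  have h : ∀ a : ZMod 109, Nat.Coprime a.val 109 → a ^ 108 = 1 := by decide +kernel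
  exact Units.ext (by rw [Units.val_pow_eq_pow_val, h _ (ZMod.val_coe_unit_coprime u), Units.val_one])

/-- `u¹⁸⁰ = 1` for every unit of `ℤ/181` (`181` prime). [cite: Washington1997, Ch. 2 Thm. 2.5] -/
theorem units_pow_oneHundredEighty_oneHundredEightyOne (u : (ZMod 181)ˣ) : u ^ (4 * 45) = 1 := by
  have h : ∀ a : ZMod 181, Nat.Coprime a.val 181 → a ^ 180 = 1 := by decide +kernel
  exact Units.ext (by rw [Units.val_pow_eq_pow_val, h _ (ZMod.val_coe_unit_coprime u), Units.val_one])

/-- `u¹⁰⁸ = 1` for every unit of `ℤ/405` (`405 = 5·3⁴`, `(ℤ/405)ˣ ≅ ℤ/4 × ℤ/54` of exponent `108`). [cite: Washington1997, Ch. 2 Thm. 2.5] -/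
theorem units_pow_oneHundredEight_fourHundredFive (u : (ZMod 405)ˣ) : u ^ (4 * 27) = 1 := by
  have h : ∀ a : ZMod 405, Nat.Coprime a.val 405 → a ^ 108 = 1 := by decide +kernel
  exact Units.ext (by rw [Units.val_pow_eq_pow_val, h _ (ZMod.val_coe_unit_coprime u), Units.val_one])

/-- **`ℚ(ζ₁₀₉)`** (CM `54`-folds; `Gal ≅ ℤ/108`, `108 = 4·3³`; divisor classes `d ∈ {3, 9, 27}` at index `2d` and `4d`): the Hodge conjecture for all powers of
every abelian variety of a type off the four subfield lists — UNCONDITIONAL. [cite: Gordon1999HodgeAVSurvey, Thm. 6.4 and §9.3] [cite: Kubota1965, §4 Lemma 2]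
[cite: Hazama2003CyclicCM, Thm. 4.8] [cite: Washington1997, Ch. 2 Thm. 2.5] -/
theorem hodgeConjectureFor_pow_of_forall_intermediateField_oneHundredNine [IsCyclotomicExtension {109} ℚ L] [IsCMField L] [IsAbelianGalois ℚ L]
    (hW : ∀ F : IntermediateField ℚ L, Module.finrank ℚ F = 2 → ¬ IsTotallyReal F →
        ¬ ∀ τ : F →+* ℂ, {φ : L →+* ℂ | φ.comp (algebraMap F L) = τ ∧ φ ∈ Φ.1}.ncard =
          {φ : L →+* ℂ | φ.comp (algebraMap F L) = τ ∧ φ ∉ Φ.1}.ncard)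
    (hQ : ∀ F : IntermediateField ℚ L, Module.finrank ℚ F = 4 → ¬ IsTotallyReal F → IsCyclic (F ≃ₐ[ℚ] F) →
        ¬ ∀ τ : F →+* ℂ, 2 * {φ : L →+* ℂ | φ.comp (algebraMap F L) = τ ∧ φ ∈ Φ.1}.ncard = Module.finrank F L)
    (hD : ∀ d : ℕ, d ∣ 27 → d ≠ 1 → ∀ F : IntermediateField ℚ L, Module.finrank ℚ F = 2 * d → ¬ IsTotallyReal F → IsCyclic (F ≃ₐ[ℚ] F) →
        ∀ [IsAbelianGalois ℚ F],
        ¬ ∀ σ : ↥d.primeFactors → (F ≃ₐ[ℚ] F), (∀ q, σ q ^ (q : ℕ) = 1) → ∀ τ : F →+* ℂ,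
          ∑ ε : ↥d.primeFactors → Bool, (∏ q, (if ε q then (-1 : ℤ) else 1)) *
            ({φ : L →+* ℂ | φ.comp (algebraMap F L) = τ.comp (∏ q, (if ε q then σ q else 1)).toRingEquiv.toRingHom ∧
              φ ∈ Φ.1}.ncard : ℤ) = 0)
    (hD4 : ∀ d : ℕ, d ∣ 27 → d ≠ 1 → ∀ F : IntermediateField ℚ L, Module.finrank ℚ F = 4 * d → ¬ IsTotallyReal F → IsCyclic (F ≃ₐ[ℚ] F) →
        ∀ [IsAbelianGalois ℚ F],
        ¬ ∀ σ : ↥d.primeFactors → (F ≃ₐ[ℚ] F), (∀ q, σ q ^ (q : ℕ) = 1) → ∀ τ : F →+* ℂ,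
          ∑ ε : ↥d.primeFactors → Bool, (∏ q, (if ε q then (-1 : ℤ) else 1)) *
            ({φ : L →+* ℂ | φ.comp (algebraMap F L) = τ.comp (∏ q, (if ε q then σ q else 1)).toRingEquiv.toRingHom ∧
              φ ∈ Φ.1}.ncard : ℤ) = 0)
    (hA : IsCMTypeRealisation Φ A ι θ) (n : ℕ) :
    HodgeConjectureFor (⨁ fun _ : Fin n => A).dim (⨁ fun _ : Fin n => A).X :=
  haveI : NeZero (109 : ℕ) := ⟨by norm_num⟩
  hodgeConjectureFor_pow_of_forall_intermediateField_of_isCyclotomicExtension (N := 109) (m := 27) (by norm_num) (by norm_num)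
    units_pow_oneHundredEight_oneHundredNine hW hQ hD hD4 hA n

/-- **`ℚ(ζ₁₈₁)`** (CM `90`-folds; `Gal ≅ ℤ/180`, `180 = 4·3²·5`; divisor classes `d ∈ {3, 5, 9, 15, 45}`): the Hodge conjecture for all powers of every abelian
variety of a type off the four subfield lists — UNCONDITIONAL. [cite: Gordon1999HodgeAVSurvey, Thm. 6.4 and §9.3] [cite: Kubota1965, §4 Lemma 2]
[cite: Hazama2003CyclicCM, Thm. 4.8] [cite: Washington1997, Ch. 2 Thm. 2.5] -/
theorem hodgeConjectureFor_pow_of_forall_intermediateField_oneHundredEightyOne [IsCyclotomicExtension {181} ℚ L] [IsCMField L] [IsAbelianGalois ℚ L]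
    (hW : ∀ F : IntermediateField ℚ L, Module.finrank ℚ F = 2 → ¬ IsTotallyReal F →
        ¬ ∀ τ : F →+* ℂ, {φ : L →+* ℂ | φ.comp (algebraMap F L) = τ ∧ φ ∈ Φ.1}.ncard =
          {φ : L →+* ℂ | φ.comp (algebraMap F L) = τ ∧ φ ∉ Φ.1}.ncard)
    (hQ : ∀ F : IntermediateField ℚ L, Module.finrank ℚ F = 4 → ¬ IsTotallyReal F → IsCyclic (F ≃ₐ[ℚ] F) →
        ¬ ∀ τ : F →+* ℂ, 2 * {φ : L →+* ℂ | φ.comp (algebraMap F L) = τ ∧ φ ∈ Φ.1}.ncard = Module.finrank F L)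
    (hD : ∀ d : ℕ, d ∣ 45 → d ≠ 1 → ∀ F : IntermediateField ℚ L, Module.finrank ℚ F = 2 * d → ¬ IsTotallyReal F → IsCyclic (F ≃ₐ[ℚ] F) →
        ∀ [IsAbelianGalois ℚ F],
        ¬ ∀ σ : ↥d.primeFactors → (F ≃ₐ[ℚ] F), (∀ q, σ q ^ (q : ℕ) = 1) → ∀ τ : F →+* ℂ,
          ∑ ε : ↥d.primeFactors → Bool, (∏ q, (if ε q then (-1 : ℤ) else 1)) *
            ({φ : L →+* ℂ | φ.comp (algebraMap F L) = τ.comp (∏ q, (if ε q then σ q else 1)).toRingEquiv.toRingHom ∧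
              φ ∈ Φ.1}.ncard : ℤ) = 0)
    (hD4 : ∀ d : ℕ, d ∣ 45 → d ≠ 1 → ∀ F : IntermediateField ℚ L, Module.finrank ℚ F = 4 * d → ¬ IsTotallyReal F → IsCyclic (F ≃ₐ[ℚ] F) →
        ∀ [IsAbelianGalois ℚ F],
        ¬ ∀ σ : ↥d.primeFactors → (F ≃ₐ[ℚ] F), (∀ q, σ q ^ (q : ℕ) = 1) → ∀ τ : F →+* ℂ,
          ∑ ε : ↥d.primeFactors → Bool, (∏ q, (if ε q then (-1 : ℤ) else 1)) *
            ({φ : L →+* ℂ | φ.comp (algebraMap F L) = τ.comp (∏ q, (if ε q then σ q else 1)).toRingEquiv.toRingHom ∧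
              φ ∈ Φ.1}.ncard : ℤ) = 0)
    (hA : IsCMTypeRealisation Φ A ι θ) (n : ℕ) :
    HodgeConjectureFor (⨁ fun _ : Fin n => A).dim (⨁ fun _ : Fin n => A).X :=
  haveI : NeZero (181 : ℕ) := ⟨by norm_num⟩
  hodgeConjectureFor_pow_of_forall_intermediateField_of_isCyclotomicExtension (N := 181) (m := 45) (by norm_num) (by norm_num)
    units_pow_oneHundredEighty_oneHundredEightyOne hW hQ hD hD4 hA n

/-- **`ℚ(ζ₄₀₅)`** (CM `108`-folds; `405 = 5·3⁴`, `Gal ≅ ℤ/4 × ℤ/54` — NOT cyclic — of exponent `108 = 4·27`; divisor classes `d ∈ {3, 9, 27}`): the Hodge conjecture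
for all powers of every abelian variety of a type off the four subfield lists — UNCONDITIONAL. [cite: Gordon1999HodgeAVSurvey, Thm. 6.4 and §9.3]
[cite: Kubota1965, §4 Lemma 2] [cite: Washington1997, Ch. 2 Thm. 2.5] -/
theorem hodgeConjectureFor_pow_of_forall_intermediateField_fourHundredFive [IsCyclotomicExtension {405} ℚ L] [IsCMField L] [IsAbelianGalois ℚ L]
    (hW : ∀ F : IntermediateField ℚ L, Module.finrank ℚ F = 2 → ¬ IsTotallyReal F →
        ¬ ∀ τ : F →+* ℂ, {φ : L →+* ℂ | φ.comp (algebraMap F L) = τ ∧ φ ∈ Φ.1}.ncard =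
          {φ : L →+* ℂ | φ.comp (algebraMap F L) = τ ∧ φ ∉ Φ.1}.ncard)
    (hQ : ∀ F : IntermediateField ℚ L, Module.finrank ℚ F = 4 → ¬ IsTotallyReal F → IsCyclic (F ≃ₐ[ℚ] F) →
        ¬ ∀ τ : F →+* ℂ, 2 * {φ : L →+* ℂ | φ.comp (algebraMap F L) = τ ∧ φ ∈ Φ.1}.ncard = Module.finrank F L)
    (hD : ∀ d : ℕ, d ∣ 27 → d ≠ 1 → ∀ F : IntermediateField ℚ L, Module.finrank ℚ F = 2 * d → ¬ IsTotallyReal F → IsCyclic (F ≃ₐ[ℚ] F) →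
        ∀ [IsAbelianGalois ℚ F],
        ¬ ∀ σ : ↥d.primeFactors → (F ≃ₐ[ℚ] F), (∀ q, σ q ^ (q : ℕ) = 1) → ∀ τ : F →+* ℂ,
          ∑ ε : ↥d.primeFactors → Bool, (∏ q, (if ε q then (-1 : ℤ) else 1)) *
            ({φ : L →+* ℂ | φ.comp (algebraMap F L) = τ.comp (∏ q, (if ε q then σ q else 1)).toRingEquiv.toRingHom ∧
              φ ∈ Φ.1}.ncard : ℤ) = 0)
    (hD4 : ∀ d : ℕ, d ∣ 27 → d ≠ 1 → ∀ F : IntermediateField ℚ L, Module.finrank ℚ F = 4 * d → ¬ IsTotallyReal F → IsCyclic (F ≃ₐ[ℚ] F) →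
        ∀ [IsAbelianGalois ℚ F],
        ¬ ∀ σ : ↥d.primeFactors → (F ≃ₐ[ℚ] F), (∀ q, σ q ^ (q : ℕ) = 1) → ∀ τ : F →+* ℂ,
          ∑ ε : ↥d.primeFactors → Bool, (∏ q, (if ε q then (-1 : ℤ) else 1)) *
            ({φ : L →+* ℂ | φ.comp (algebraMap F L) = τ.comp (∏ q, (if ε q then σ q else 1)).toRingEquiv.toRingHom ∧
              φ ∈ Φ.1}.ncard : ℤ) = 0)
    (hA : IsCMTypeRealisation Φ A ι θ) (n : ℕ) :
    HodgeConjectureFor (⨁ fun _ : Fin n => A).dim (⨁ fun _ : Fin n => A).X :=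
  haveI : NeZero (405 : ℕ) := ⟨by norm_num⟩
  hodgeConjectureFor_pow_of_forall_intermediateField_of_isCyclotomicExtension (N := 405) (m := 27) (by norm_num) (by norm_num)
    units_pow_oneHundredEight_fourHundredFive hW hQ hD hD4 hA n

end Cyclotomic

end ExponentFourOdd

end Literature.AlgebraicGeometry.Pohlmann1968
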